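import Literature.NumberTheory.Rogawski1990.Ch3Sec13Prop3132Holds
import HarnessLib

/-!
# [Rogawski1990, §3.13] PROPOSITION 3.13.2 (a) — the typed letter `prop3132aLocal` FAILS at the archimedean place (three classes, not two)

Kernel-lane companion of ★ `Literature/NumberTheory/Rogawski1990/Ch3Sec10to13.lean` (TR-t09 g0, p848035; ED. 2 p858213), sibling of ★
`Ch3Sec12Prop3121ArchCounterexamples` (p858101).  The carpet types PROP. 3.13.2 (a) «If `N(δ)` is not central, `𝒟_ε(δ/F)` is naturally isomorphic to
`F*/NE*`» as the COUNT «exactly two `ε`-classes modulo `F*` in `𝒪_{ε-st}(δ)`» for every LOCAL `F` (`∃ τ, IsLocalField F` — the real place included).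
The print derives (a) «from Proposition 3.11.2(b) and (3.8.1)» (p. 38), and the injectivity of (3.8.1) `H¹(F, U(2)) → H¹(F, E¹)` (p. 31) is a `p`-adic
statement; at `E/F = ℂ/ℝ` the count is THREE (`H¹(ℝ, U(V_a) × U(V_b)) / H¹(ℝ, Z) = (3·2)/2`; in `*`-congruence terms: the sign data of the cosquare
eigenvalues `{a, a}` and `{b}` up to a global flip — `(++;+)`, `(++;−)`, `(+−;+)`).

THIS FILE PROVES `exists_not_prop3132aLocal : ∃ Φ : GL (Fin 3) ℂ, ¬ prop3132aLocal ℝ ℂ Complex.conjAe Φ` with Rogawski's own `Φ = Φ₃ =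
antidiag(1, −1, 1)` (`G = U(2,1)`): the three elements `δ_s = diag(s₁, s₂, s₃ i) Φ₃`, `s ∈ {(1,1,1), (1,1,−1), (1,−1,1)}`, all have
`N(δ_s) = δ_s ε(δ_s) = diag(1, 1, −1)` (`ε`-semisimple, not `ε`-regular, not central — the hypotheses of (a) at `δ = δ_{(1,1,1)}`), hence lie in ONE stable
`ε`-class; an `ε`-conjugacy modulo `F*` `y δ_s ε(y)⁻¹ = z δ_{s′}` (`z = c·1`, `c ∈ ℝ*`) unwinds to the `*`-congruence `y diag(s) ᵗȳ = c diag(s′)`, and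
the diagonal entries `Σ_k s_k |y_{ik}|² = c s′_i` at `(2,2)` and at one more place force `c = 0` for each of the three pairs — so no two of the three are
`ε`-conjugate modulo `F*`, and no pair `δ₁, δ₂` as in ★ `HasTwoClassesModF` can absorb all three (two relations to the same target compose to a relation
between the sources, `isEpsConjModF_combine`).  The standing hypotheses are met as in the sibling file (★ `IsLocalField.real`, `[ℂ:ℝ] = 2`, `conj ≠ 1`,
`Φ₃` hermitian `= rogawskiPhi ℂ 3`).  CONSEQUENCE FOR THE BOOKS (desk ∕ director, policy «D758-β»): ★ `prop3132aLocal` is unprovable as typed; the faithful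
letter is the `p`-adic one (`IsPadicField F`).  ★ `prop3132bPadic` ∕ ★ `prop3132bReal` are NOT affected (central `N(δ)`: one ∕ two classes, as printed).
No tree file takes `prop3132aLocal` as a hypothesis (checked by `rg`, 2026-09-04).  THEOREMS ONLY (0 def ∕ fact ∕ sorry ∕ instance ∕ notation); cell
hodgecm-mathlib, B-typ03 (g33).  HC_CM is proved only modulo the printed citations until rung 0 closes; nothing here bears on it.

## References
* [Rogawski1990] J. D. Rogawski, *Automorphic Representations of Unitary Groups in Three Variables*, Ann. of Math. Stud. 123 (1990), §3.13
  Prop. 3.13.2 (a) and proof, p. 38 (chunk p0042); §3.11 p. 35 (`𝒟_ε(δ/F)` modulo `F*`, chunk p0039); §3.8 (3.8.1) p. 31 (chunk p0034); §1.9 p. 8 (`Φ₃`).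
-/

noncomputable section

open scoped MatrixGroups

namespace Literature.NumberTheory.Rogawski1990.Ch3Sec10to13

open scoped Matrix ComplexConjugate
open Complex
open Literature.NumberTheory.Rogawski1990 (IsRegularElt)
open Literature.NumberTheory.Rogawski1990.Ch4Sec10 (unitaryTwist epsNorm IsEpsConj fixedScalarSubgroup IsEpsRegular IsStablyEpsConj)
open Literature.NumberTheory.GaloisRepresentations (glTransposeInv coe_glTransposeInv_apply IsLocalField)

section RealCounterexampleThree

/-! ### The data: `Φ₃ = antidiag(1, −1, 1)`, `N₀ = diag(1, 1, −1)`, `δ_s = diag(s) · Φ₃` -/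

/-- `det Φ₃ ≠ 0`. [folklore] -/
private theorem det_J3_ne_zero : Matrix.det !![(0 : ℂ), 0, 1; 0, -1, 0; 1, 0, 0] ≠ 0 := by
  simp [Matrix.det_fin_three]

/-- `det diag(d) ≠ 0` for the four diagonals used below. [folklore] -/
private theorem det_diag_ne_zero (d : Fin 3 → ℂ) (h0 : d 0 ≠ 0) (h1 : d 1 ≠ 0) (h2 : d 2 ≠ 0) :
    Matrix.det (Matrix.diagonal d) ≠ 0 := by
  rw [Matrix.det_diagonal, Fin.prod_univ_three]
  exact mul_ne_zero (mul_ne_zero h0 h1) h2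

/-- The matrix of `mkOfDetNeZero A h` is `A`. [folklore] -/
private theorem coe_mkOfDetNeZero (A : Matrix (Fin 3) (Fin 3) ℂ) (h : Matrix.det A ≠ 0) :
    ((Matrix.GeneralLinearGroup.mkOfDetNeZero A h : GL (Fin 3) ℂ) : Matrix (Fin 3) (Fin 3) ℂ) = A := rfl

/-- `Φ₃` is Rogawski's `Φ₃`. [cite: Rogawski1990, §1.9 p. 8] -/
private theorem J3_eq_rogawskiPhi : !![(0 : ℂ), 0, 1; 0, -1, 0; 1, 0, 0] = rogawskiPhi ℂ 3 := by
  ext i j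
  fin_cases i <;> fin_cases j <;> simp [rogawskiPhi]

/-- `Φ₃` is hermitian (real symmetric). [folklore] -/
private theorem J3_hermitian :
    ((!![(0 : ℂ), 0, 1; 0, -1, 0; 1, 0, 0]).map (Complex.conjAe : ℂ →+* ℂ))ᵀ = !![(0 : ℂ), 0, 1; 0, -1, 0; 1, 0, 0] := by
  ext i j
  fin_cases i <;> fin_cases j <;> simp

/-- The standing hypotheses hold for `F = ℝ`, `E = ℂ`, `σ` = conjugation, `Φ = Φ₃`. [folklore] -/
private theorem standing_real3 (Φ : GL (Fin 3) ℂ)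
    (hΦ : ((Φ : GL (Fin 3) ℂ) : Matrix (Fin 3) (Fin 3) ℂ) = !![(0 : ℂ), 0, 1; 0, -1, 0; 1, 0, 0]) :
    Standing ℝ ℂ Complex.conjAe Φ := by
  refine ⟨⟨inferInstance, Or.inr ⟨inferInstance, IsLocalField.real⟩⟩, ⟨Complex.finrank_real_complex, ?_⟩, ?_⟩
  · intro h
    have h1 := congrArg (fun τ : ℂ ≃ₐ[ℝ] ℂ => τ I) h
    have h1' : conj I = I := by simpa using h1
    rw [Complex.conj_I] at h1'
    have h2 : I = 0 := by linear_combination (-1 / 2 : ℂ) * h1'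
    exact I_ne_zero h2
  · rw [hΦ]; exact J3_hermitian

/-! ### `ε`-norms: `N(δ) = N` from the matrix identity `ᵗσ(δ) Φ = Φ N δ` (`N² = 1`) -/

/-- If `N² = 1` and `ᵗ(σδ) Φ = Φ N δ` then `N(δ) = δ ε(δ) = N`. [cite: Rogawski1990, §3.10 p. 33] -/
private theorem epsNorm_eq_of (Φ δ N : GL (Fin 3) ℂ) (hN : N * N = 1)
    (hK : ((((δ : GL (Fin 3) ℂ) : Matrix (Fin 3) (Fin 3) ℂ).map (Complex.conjAe : ℂ →+* ℂ))ᵀ) * (Φ : Matrix (Fin 3) (Fin 3) ℂ) =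
      (Φ : Matrix (Fin 3) (Fin 3) ℂ) * (N : Matrix (Fin 3) (Fin 3) ℂ) * (δ : Matrix (Fin 3) (Fin 3) ℂ)) :
    epsNorm (unitaryTwist (Complex.conjAe : ℂ →+* ℂ) Φ) δ = N := by
  have h1 : unitaryTwist (Complex.conjAe : ℂ →+* ℂ) Φ δ =
      Φ⁻¹ * glTransposeInv (Fin 3) ℂ (Matrix.GeneralLinearGroup.map (Complex.conjAe : ℂ →+* ℂ) δ) * Φ := rfl
  have hKGL : (glTransposeInv (Fin 3) ℂ (Matrix.GeneralLinearGroup.map (Complex.conjAe : ℂ →+* ℂ) δ))⁻¹ * Φ = Φ * N * δ := by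
    refine Units.ext ?_
    simp only [Units.val_mul]
    exact hK
  have hNinv : N⁻¹ = N := inv_eq_of_mul_eq_one_right hN
  have h2 : glTransposeInv (Fin 3) ℂ (Matrix.GeneralLinearGroup.map (Complex.conjAe : ℂ →+* ℂ) δ) = Φ * (Φ * N * δ)⁻¹ := by
    calc glTransposeInv (Fin 3) ℂ (Matrix.GeneralLinearGroup.map (Complex.conjAe : ℂ →+* ℂ) δ)
        = Φ * ((glTransposeInv (Fin 3) ℂ (Matrix.GeneralLinearGroup.map (Complex.conjAe : ℂ →+* ℂ) δ))⁻¹ * Φ)⁻¹ := by group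
      _ = Φ * (Φ * N * δ)⁻¹ := by rw [hKGL]
  show δ * unitaryTwist (Complex.conjAe : ℂ →+* ℂ) Φ δ = N
  rw [h1, h2]
  calc δ * (Φ⁻¹ * (Φ * (Φ * N * δ)⁻¹) * Φ) = N⁻¹ := by group
    _ = N := hNinv

/-- `ᵗσ(diag(d) Φ₃) Φ₃ = Φ₃ N₀ (diag(d) Φ₃)` for the three diagonals `d ∈ {(1,1,i), (1,1,−i), (1,−1,i)}`, `N₀ = diag(1,1,−1)`. [folklore] -/
private theorem key_identity_A :
    (((Matrix.diagonal ![(1 : ℂ), 1, I] * !![(0 : ℂ), 0, 1; 0, -1, 0; 1, 0, 0]).map (Complex.conjAe : ℂ →+* ℂ))ᵀ) *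
        !![(0 : ℂ), 0, 1; 0, -1, 0; 1, 0, 0] =
      !![(0 : ℂ), 0, 1; 0, -1, 0; 1, 0, 0] * Matrix.diagonal ![(1 : ℂ), 1, -1] *
        (Matrix.diagonal ![(1 : ℂ), 1, I] * !![(0 : ℂ), 0, 1; 0, -1, 0; 1, 0, 0]) := by
  ext i j
  fin_cases i <;> fin_cases j <;> simp [Matrix.mul_apply, Fin.sum_univ_three, Matrix.vecMul_diagonal]

/-- `ᵗσ(diag(1,1,−i) Φ₃) Φ₃ = Φ₃ N₀ (diag(1,1,−i) Φ₃)`. [folklore] -/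
private theorem key_identity_B :
    (((Matrix.diagonal ![(1 : ℂ), 1, -I] * !![(0 : ℂ), 0, 1; 0, -1, 0; 1, 0, 0]).map (Complex.conjAe : ℂ →+* ℂ))ᵀ) *
        !![(0 : ℂ), 0, 1; 0, -1, 0; 1, 0, 0] =
      !![(0 : ℂ), 0, 1; 0, -1, 0; 1, 0, 0] * Matrix.diagonal ![(1 : ℂ), 1, -1] *
        (Matrix.diagonal ![(1 : ℂ), 1, -I] * !![(0 : ℂ), 0, 1; 0, -1, 0; 1, 0, 0]) := by
  ext i j
  fin_cases i <;> fin_cases j <;> simp [Matrix.mul_apply, Fin.sum_univ_three, Matrix.vecMul_diagonal]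

/-- `ᵗσ(diag(1,−1,i) Φ₃) Φ₃ = Φ₃ N₀ (diag(1,−1,i) Φ₃)`. [folklore] -/
private theorem key_identity_C :
    (((Matrix.diagonal ![(1 : ℂ), -1, I] * !![(0 : ℂ), 0, 1; 0, -1, 0; 1, 0, 0]).map (Complex.conjAe : ℂ →+* ℂ))ᵀ) *
        !![(0 : ℂ), 0, 1; 0, -1, 0; 1, 0, 0] =
      !![(0 : ℂ), 0, 1; 0, -1, 0; 1, 0, 0] * Matrix.diagonal ![(1 : ℂ), 1, -1] *
        (Matrix.diagonal ![(1 : ℂ), -1, I] * !![(0 : ℂ), 0, 1; 0, -1, 0; 1, 0, 0]) := by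
  ext i j
  fin_cases i <;> fin_cases j <;> simp [Matrix.mul_apply, Fin.sum_univ_three, Matrix.vecMul_diagonal]

/-! ### `ε`-conjugacy modulo `F*` unwinds to a `*`-congruence of the diagonals -/

/-- From `y (D Φ) ε(y)⁻¹ = z (D′ Φ)` with `z = c · 1`: `y D ᵗȳ = c D′` as matrices. [folklore] -/
private theorem congr_of_isEpsConj (Φ D D' y : GL (Fin 3) ℂ) (c : ℂˣ)
    (h : y * (D * Φ) * (unitaryTwist (Complex.conjAe : ℂ →+* ℂ) Φ y)⁻¹ =
      Matrix.GeneralLinearGroup.scalar (Fin 3) c * (D' * Φ)) :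
    ((y : GL (Fin 3) ℂ) : Matrix (Fin 3) (Fin 3) ℂ) * (D : Matrix (Fin 3) (Fin 3) ℂ) *
        ((((y : GL (Fin 3) ℂ) : Matrix (Fin 3) (Fin 3) ℂ).map (Complex.conjAe : ℂ →+* ℂ))ᵀ) =
      (c : ℂ) • (D' : Matrix (Fin 3) (Fin 3) ℂ) := by
  have h1 : unitaryTwist (Complex.conjAe : ℂ →+* ℂ) Φ y =
      Φ⁻¹ * glTransposeInv (Fin 3) ℂ (Matrix.GeneralLinearGroup.map (Complex.conjAe : ℂ →+* ℂ) y) * Φ := rfl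
  have h2 : y * D * (glTransposeInv (Fin 3) ℂ (Matrix.GeneralLinearGroup.map (Complex.conjAe : ℂ →+* ℂ) y))⁻¹ =
      Matrix.GeneralLinearGroup.scalar (Fin 3) c * D' := by
    calc y * D * (glTransposeInv (Fin 3) ℂ (Matrix.GeneralLinearGroup.map (Complex.conjAe : ℂ →+* ℂ) y))⁻¹
        = (y * (D * Φ) * (Φ⁻¹ * glTransposeInv (Fin 3) ℂ (Matrix.GeneralLinearGroup.map (Complex.conjAe : ℂ →+* ℂ) y) *
            Φ)⁻¹) * Φ⁻¹ := by group
      _ = Matrix.GeneralLinearGroup.scalar (Fin 3) c * (D' * Φ) * Φ⁻¹ := by rw [← h1, h]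
      _ = Matrix.GeneralLinearGroup.scalar (Fin 3) c * D' := by group
  have h3 := congrArg (fun u : GL (Fin 3) ℂ => (u : Matrix (Fin 3) (Fin 3) ℂ)) h2
  simp only [Units.val_mul, Matrix.GeneralLinearGroup.coe_scalar] at h3
  rw [Matrix.scalar_apply, ← Matrix.smul_one_eq_diagonal, Matrix.smul_mul, Matrix.one_mul] at h3
  have hcoe : (((glTransposeInv (Fin 3) ℂ (Matrix.GeneralLinearGroup.map (Complex.conjAe : ℂ →+* ℂ) y))⁻¹ :
      GL (Fin 3) ℂ) : Matrix (Fin 3) (Fin 3) ℂ) =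
        ((((y : GL (Fin 3) ℂ) : Matrix (Fin 3) (Fin 3) ℂ).map (Complex.conjAe : ℂ →+* ℂ))ᵀ) := rfl
  rw [hcoe] at h3
  exact h3

/-- The diagonal entry `(i,i)` of `Y diag(d) ᵗȲ` is `Σ_k d_k |Y_{ik}|²`. [folklore] -/
private theorem congr_diag_entry (Y : Matrix (Fin 3) (Fin 3) ℂ) (d : Fin 3 → ℂ) (i : Fin 3) :
    (Y * Matrix.diagonal d * (Y.map (Complex.conjAe : ℂ →+* ℂ))ᵀ) i i =
      d 0 * Complex.normSq (Y i 0) + d 1 * Complex.normSq (Y i 1) + d 2 * Complex.normSq (Y i 2) := by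
  simp [Matrix.mul_apply, Fin.sum_univ_three, Matrix.diagonal]
  rw [← Complex.mul_conj, ← Complex.mul_conj, ← Complex.mul_conj]
  ring

/-- The diagonal entries of a `*`-congruence `Y diag(d) ᵗȲ = c · diag(d′)`, as scalar identities. [folklore] -/
private theorem entry_eq (Y : Matrix (Fin 3) (Fin 3) ℂ) (c : ℂ) (d d' : Fin 3 → ℂ)
    (h : Y * Matrix.diagonal d * (Y.map (Complex.conjAe : ℂ →+* ℂ))ᵀ = c • Matrix.diagonal d') (i : Fin 3) :
    d 0 * Complex.normSq (Y i 0) + d 1 * Complex.normSq (Y i 1) + d 2 * Complex.normSq (Y i 2) = c * d' i := by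
  have := congrArg (fun M : Matrix (Fin 3) (Fin 3) ℂ => M i i) h
  rw [congr_diag_entry, Matrix.smul_apply, Matrix.diagonal_apply_eq, smul_eq_mul] at this
  exact this

/-- `diag(1,1,i)` and `c·diag(1,1,−i)` (`c ∈ ℝ*`) are not `*`-congruent. [folklore] -/
private theorem no_congr_AB (Y : Matrix (Fin 3) (Fin 3) ℂ) (c : ℂ) (hc0 : c ≠ 0) (hcim : c.im = 0)
    (h : Y * Matrix.diagonal ![(1 : ℂ), 1, I] * (Y.map (Complex.conjAe : ℂ →+* ℂ))ᵀ = c • Matrix.diagonal ![(1 : ℂ), 1, -I]) :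
    False := by
  have e2 := congrArg Complex.im (entry_eq Y c _ _ h 2)
  have e0 := congrArg Complex.re (entry_eq Y c _ _ h 0)
  simp [hcim] at e2 e0
  have hre : c.re = 0 := by
    nlinarith [Complex.normSq_nonneg (Y 2 2), Complex.normSq_nonneg (Y 0 0), Complex.normSq_nonneg (Y 0 1)]
  exact hc0 (Complex.ext (by simpa using hre) (by simpa using hcim))

/-- `diag(1,1,i)` and `c·diag(1,−1,i)` (`c ∈ ℝ*`) are not `*`-congruent. [folklore] -/
private theorem no_congr_AC (Y : Matrix (Fin 3) (Fin 3) ℂ) (c : ℂ) (hc0 : c ≠ 0) (hcim : c.im = 0)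
    (h : Y * Matrix.diagonal ![(1 : ℂ), 1, I] * (Y.map (Complex.conjAe : ℂ →+* ℂ))ᵀ = c • Matrix.diagonal ![(1 : ℂ), -1, I]) :
    False := by
  have e2 := congrArg Complex.im (entry_eq Y c _ _ h 2)
  have e1 := congrArg Complex.re (entry_eq Y c _ _ h 1)
  simp [hcim] at e2 e1
  have hre : c.re = 0 := by
    nlinarith [Complex.normSq_nonneg (Y 2 2), Complex.normSq_nonneg (Y 1 0), Complex.normSq_nonneg (Y 1 1)]
  exact hc0 (Complex.ext (by simpa using hre) (by simpa using hcim))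

/-- `diag(1,1,−i)` and `c·diag(1,−1,i)` (`c ∈ ℝ*`) are not `*`-congruent. [folklore] -/
private theorem no_congr_BC (Y : Matrix (Fin 3) (Fin 3) ℂ) (c : ℂ) (hc0 : c ≠ 0) (hcim : c.im = 0)
    (h : Y * Matrix.diagonal ![(1 : ℂ), 1, -I] * (Y.map (Complex.conjAe : ℂ →+* ℂ))ᵀ = c • Matrix.diagonal ![(1 : ℂ), -1, I]) :
    False := by
  have e2 := congrArg Complex.im (entry_eq Y c _ _ h 2)
  have e0 := congrArg Complex.re (entry_eq Y c _ _ h 0)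
  simp [hcim] at e2 e0
  have hre : c.re = 0 := by
    nlinarith [Complex.normSq_nonneg (Y 2 2), Complex.normSq_nonneg (Y 0 0), Complex.normSq_nonneg (Y 0 1)]
  exact hc0 (Complex.ext (by simpa using hre) (by simpa using hcim))

/-! ### Two relations to the same target combine -/

/-- Scalars of `F*` are central in `GL₃`. [folklore] -/
private theorem fixedScalar_comm {z : GL (Fin 3) ℂ} (hz : z ∈ fixedScalarSubgroup (Complex.conjAe : ℂ →+* ℂ))
    (g : GL (Fin 3) ℂ) : z * g = g * z := by
  obtain ⟨c, -, rfl⟩ := hz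
  exact Matrix.GeneralLinearGroup.scalar_commute c g

/-- If `X` and `Y` are both `ε`-conjugate modulo `F*` to `T`, then `Y` is `ε`-conjugate modulo `F*` to `X`. [folklore] -/
private theorem isEpsConjModF_combine {Φ X Y T : GL (Fin 3) ℂ} (hX : IsEpsConjModF ℝ ℂ Complex.conjAe Φ X T)
    (hY : IsEpsConjModF ℝ ℂ Complex.conjAe Φ Y T) : IsEpsConjModF ℝ ℂ Complex.conjAe Φ Y X := by
  obtain ⟨z₁, hz₁, y₁, h₁⟩ := hX
  obtain ⟨z₂, hz₂, y₂, h₂⟩ := hY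
  have hmem : z₂ * z₁⁻¹ ∈ fixedScalarSubgroup (Complex.conjAe : ℂ →+* ℂ) := Subgroup.mul_mem _ hz₂ (Subgroup.inv_mem _ hz₁)
  refine ⟨z₂ * z₁⁻¹, hmem, y₁⁻¹ * y₂, ?_⟩
  have hT : T = z₁⁻¹ * (y₁ * X * (unitaryTwist (Complex.conjAe : ℂ →+* ℂ) Φ y₁)⁻¹) := by rw [h₁]; group
  have hzc := fixedScalar_comm hmem y₁
  rw [map_mul, map_inv]
  calc y₁⁻¹ * y₂ * Y * ((unitaryTwist (Complex.conjAe : ℂ →+* ℂ) Φ y₁)⁻¹ * unitaryTwist (Complex.conjAe : ℂ →+* ℂ) Φ y₂)⁻¹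
      = y₁⁻¹ * (y₂ * Y * (unitaryTwist (Complex.conjAe : ℂ →+* ℂ) Φ y₂)⁻¹) * unitaryTwist (Complex.conjAe : ℂ →+* ℂ) Φ y₁ := by
        group
    _ = y₁⁻¹ * (z₂ * T) * unitaryTwist (Complex.conjAe : ℂ →+* ℂ) Φ y₁ := by rw [h₂]
    _ = y₁⁻¹ * (z₂ * (z₁⁻¹ * (y₁ * X * (unitaryTwist (Complex.conjAe : ℂ →+* ℂ) Φ y₁)⁻¹))) *
          unitaryTwist (Complex.conjAe : ℂ →+* ℂ) Φ y₁ := by rw [← hT]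
    _ = y₁⁻¹ * ((z₂ * z₁⁻¹) * y₁) * X := by group
    _ = y₁⁻¹ * (y₁ * (z₂ * z₁⁻¹)) * X := by rw [hzc]
    _ = z₂ * z₁⁻¹ * X := by group

/-! ### The counterexample -/

/-- `det diag(1,1,i) ≠ 0`. [folklore] -/
private theorem det_dA : Matrix.det (Matrix.diagonal ![(1 : ℂ), 1, I]) ≠ 0 :=
  det_diag_ne_zero _ one_ne_zero one_ne_zero I_ne_zero
/-- `det diag(1,1,−i) ≠ 0`. [folklore] -/
private theorem det_dB : Matrix.det (Matrix.diagonal ![(1 : ℂ), 1, -I]) ≠ 0 :=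
  det_diag_ne_zero _ one_ne_zero one_ne_zero (neg_ne_zero.2 I_ne_zero)
/-- `det diag(1,−1,i) ≠ 0`. [folklore] -/
private theorem det_dC : Matrix.det (Matrix.diagonal ![(1 : ℂ), -1, I]) ≠ 0 :=
  det_diag_ne_zero _ one_ne_zero (neg_ne_zero.2 one_ne_zero) I_ne_zero
/-- `det diag(1,1,−1) ≠ 0`. [folklore] -/
private theorem det_dN : Matrix.det (Matrix.diagonal ![(1 : ℂ), 1, -1]) ≠ 0 :=
  det_diag_ne_zero _ one_ne_zero one_ne_zero (neg_ne_zero.2 one_ne_zero)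

/-- An `ε`-conjugacy modulo `F*` between `diag(d) Φ₃` and `diag(d′) Φ₃` yields the `*`-congruence `Y diag(d) ᵗȲ = c·diag(d′)`, `c ∈ ℝ*`. [folklore] -/
private theorem congr_of_isEpsConjModF (Φ : GL (Fin 3) ℂ) {d d' : Fin 3 → ℂ} (hd : Matrix.det (Matrix.diagonal d) ≠ 0)
    (hd' : Matrix.det (Matrix.diagonal d') ≠ 0)
    (h : IsEpsConjModF ℝ ℂ Complex.conjAe Φ (Matrix.GeneralLinearGroup.mkOfDetNeZero _ hd * Φ)
      (Matrix.GeneralLinearGroup.mkOfDetNeZero _ hd' * Φ)) :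
    ∃ (Y : Matrix (Fin 3) (Fin 3) ℂ) (c : ℂ), c ≠ 0 ∧ c.im = 0 ∧
      Y * Matrix.diagonal d * (Y.map (Complex.conjAe : ℂ →+* ℂ))ᵀ = c • Matrix.diagonal d' := by
  obtain ⟨z, ⟨c, hc, rfl⟩, y, hy⟩ := h
  have hc' : Units.map ((Complex.conjAe : ℂ →+* ℂ) : ℂ →* ℂ) c = MonoidHom.id ℂˣ c := hc
  have hcc : conj (c : ℂ) = c := by simpa using congrArg Units.val hc'
  refine ⟨y, c, Units.ne_zero c, Complex.conj_eq_iff_im.1 hcc, ?_⟩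
  have h3 := congr_of_isEpsConj Φ (Matrix.GeneralLinearGroup.mkOfDetNeZero _ hd)
    (Matrix.GeneralLinearGroup.mkOfDetNeZero _ hd') y c hy
  rw [coe_mkOfDetNeZero, coe_mkOfDetNeZero] at h3
  exact h3

/-- **PROP. 3.13.2 (a) AS TYPED fails at the archimedean place.**  For `F = ℝ`, `E = ℂ`, `σ` = conjugation, `Φ = Φ₃` (`n = 3`,
`G = U(2,1)`), the elements `δ_s = diag(s₁, s₂, s₃ i) Φ₃` with `s = (1,1,1), (1,1,−1), (1,−1,1)` all have `N(δ_s) = diag(1, 1, −1)` — `ε`-semisimple,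
not `ε`-regular, not central — so they lie in one stable `ε`-class; an `ε`-conjugacy modulo `F*` between two of them is a `*`-congruence
`y diag(s) ᵗȳ = c·diag(s′)` (`c ∈ ℝ*`), and reading the `(2,2)` and one more diagonal entry gives `Σ ± |y_{ij}|²` identities forcing `c = 0`.  Hence
there are at least THREE `ε`-classes modulo `F*` (in fact exactly three: `H¹(ℝ, U(V_a) × U(V_b))/H¹(ℝ, Z) = 6/2`), not two as ★ `prop3132aLocal` asserts for
every LOCAL `F`.  The print's (a) «follows from Proposition 3.11.2(b) and (3.8.1)» (p. 38), and (3.8.1)'s injectivity is a `p`-adic statement (p. 31); the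
faithful letter carries `IsPadicField F` (for the desk to book). [cite: Rogawski1990, §3.13 Prop. 3.13.2 (a) p. 38 (chunk p0042); §3.8 (3.8.1) p. 31 (chunk p0034)] -/
theorem exists_not_prop3132aLocal : ∃ Φ : GL (Fin 3) ℂ, ¬ prop3132aLocal ℝ ℂ Complex.conjAe Φ := by
  refine ⟨Matrix.GeneralLinearGroup.mkOfDetNeZero _ det_J3_ne_zero, fun h => ?_⟩
  set Φg : GL (Fin 3) ℂ := Matrix.GeneralLinearGroup.mkOfDetNeZero _ det_J3_ne_zero with hΦg
  set N₀ : GL (Fin 3) ℂ := Matrix.GeneralLinearGroup.mkOfDetNeZero _ det_dN with hN₀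
  set δA : GL (Fin 3) ℂ := Matrix.GeneralLinearGroup.mkOfDetNeZero _ det_dA * Φg with hδA
  set δB : GL (Fin 3) ℂ := Matrix.GeneralLinearGroup.mkOfDetNeZero _ det_dB * Φg with hδB
  set δC : GL (Fin 3) ℂ := Matrix.GeneralLinearGroup.mkOfDetNeZero _ det_dC * Φg with hδC
  have hN0sq : N₀ * N₀ = 1 := by
    refine Units.ext ?_
    change Matrix.diagonal ![(1 : ℂ), 1, -1] * Matrix.diagonal ![(1 : ℂ), 1, -1] = 1
    rw [Matrix.diagonal_mul_diagonal, ← Matrix.diagonal_one]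
    congr 1
    ext i; fin_cases i <;> simp
  -- the three norms
  have hNA : epsNorm (unitaryTwist (Complex.conjAe : ℂ →+* ℂ) Φg) δA = N₀ := epsNorm_eq_of Φg δA N₀ hN0sq key_identity_A
  have hNB : epsNorm (unitaryTwist (Complex.conjAe : ℂ →+* ℂ) Φg) δB = N₀ := epsNorm_eq_of Φg δB N₀ hN0sq key_identity_B
  have hNC : epsNorm (unitaryTwist (Complex.conjAe : ℂ →+* ℂ) Φg) δC = N₀ := epsNorm_eq_of Φg δC N₀ hN0sq key_identity_C
  -- hypotheses of the letter at `δ = δA`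
  have hΦ : ((Φg : GL (Fin 3) ℂ) : Matrix (Fin 3) (Fin 3) ℂ) = rogawskiPhi ℂ 3 := J3_eq_rogawskiPhi
  have hss : IsEpsSemisimple ℝ ℂ Complex.conjAe Φg δA := by
    change Module.End.IsSemisimple (Matrix.toLin'
      (((epsNorm (unitaryTwist (Complex.conjAe : ℂ →+* ℂ) Φg) δA : GL (Fin 3) ℂ) : Matrix (Fin 3) (Fin 3) ℂ)))
    rw [hNA]
    exact isSemisimple_toLin'_diagonal ℂ _
  have hnreg : ¬ IsEpsRegular (Complex.conjAe : ℂ →+* ℂ) Φg δA := by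
    intro hreg
    change (((epsNorm (unitaryTwist (Complex.conjAe : ℂ →+* ℂ) Φg) δA : GL (Fin 3) ℂ) : Matrix (Fin 3) (Fin 3) ℂ).charpoly).Separable
      at hreg
    rw [hNA] at hreg
    change ((Matrix.diagonal ![(1 : ℂ), 1, -1]).charpoly).Separable at hreg
    rw [Matrix.charpoly_diagonal, Fin.prod_univ_three] at hreg
    simp only [Matrix.cons_val_zero, Matrix.cons_val_one, Matrix.head_cons, Matrix.cons_val_two, Matrix.tail_cons] at hreg
    have hsq := hreg.squarefree (Polynomial.X - Polynomial.C 1) ⟨Polynomial.X - Polynomial.C (-1), by ring⟩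
    exact Polynomial.not_isUnit_X_sub_C (1 : ℂ) hsq
  have hncen : epsNorm (unitaryTwist (Complex.conjAe : ℂ →+* ℂ) Φg) δA ∉ Subgroup.center (GL (Fin 3) ℂ) := by
    rw [hNA, Matrix.GeneralLinearGroup.center_eq_range_scalar]
    rintro ⟨c, hc⟩
    have h00 := congrArg (fun u : GL (Fin 3) ℂ => (u : Matrix (Fin 3) (Fin 3) ℂ) 0 0) hc
    have h22 := congrArg (fun u : GL (Fin 3) ℂ => (u : Matrix (Fin 3) (Fin 3) ℂ) 2 2) hc
    simp [Matrix.GeneralLinearGroup.coe_scalar] at h00 h22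
    change (c : ℂ) = (Matrix.diagonal ![(1 : ℂ), 1, -1]) 0 0 at h00
    change (c : ℂ) = (Matrix.diagonal ![(1 : ℂ), 1, -1]) 2 2 at h22
    simp at h00 h22
    rw [h00] at h22
    norm_num at h22
  -- apply the letter
  obtain ⟨δ₁, δ₂, -, -, -, hall⟩ :=
    h (standing_real3 Φg rfl) hΦ ⟨inferInstance, IsLocalField.real⟩ δA hss hnreg hncen
  have stab : ∀ δ' : GL (Fin 3) ℂ, epsNorm (unitaryTwist (Complex.conjAe : ℂ →+* ℂ) Φg) δ' = N₀ →
      IsStablyEpsConj (Complex.conjAe : ℂ →+* ℂ) Φg δA δ' := by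
    intro δ' hδ'
    change IsConj (epsNorm (unitaryTwist (Complex.conjAe : ℂ →+* ℂ) Φg) δA) (epsNorm (unitaryTwist (Complex.conjAe : ℂ →+* ℂ) Φg) δ')
    rw [hNA, hδ']
  have notAB : ¬ IsEpsConjModF ℝ ℂ Complex.conjAe Φg δA δB := fun hr => by
    obtain ⟨Y, c, hc0, hcim, hY⟩ := congr_of_isEpsConjModF Φg det_dA det_dB hr
    exact no_congr_AB Y c hc0 hcim hY
  have notAC : ¬ IsEpsConjModF ℝ ℂ Complex.conjAe Φg δA δC := fun hr => by
    obtain ⟨Y, c, hc0, hcim, hY⟩ := congr_of_isEpsConjModF Φg det_dA det_dC hr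
    exact no_congr_AC Y c hc0 hcim hY
  have notBC : ¬ IsEpsConjModF ℝ ℂ Complex.conjAe Φg δB δC := fun hr => by
    obtain ⟨Y, c, hc0, hcim, hY⟩ := congr_of_isEpsConjModF Φg det_dB det_dC hr
    exact no_congr_BC Y c hc0 hcim hY
  rcases hall δA (stab δA hNA) with hA1 | hA2 <;> rcases hall δB (stab δB hNB) with hB1 | hB2
  · exact notAB (isEpsConjModF_combine hB1 hA1)
  · rcases hall δC (stab δC hNC) with hC1 | hC2
    · exact notAC (isEpsConjModF_combine hC1 hA1)
    · exact notBC (isEpsConjModF_combine hC2 hB2)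
  · rcases hall δC (stab δC hNC) with hC1 | hC2
    · exact notBC (isEpsConjModF_combine hC1 hB1)
    · exact notAC (isEpsConjModF_combine hC2 hA2)
  · exact notAB (isEpsConjModF_combine hB2 hA2)

end RealCounterexampleThree

end Literature.NumberTheory.Rogawski1990.Ch3Sec10to13

end
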